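import Summits.QuantumFields.YangMills.Theorems.UnitScaleTiltProp7TransportTelescoping
import Literature.MathematicalPhysics.QuantumFieldTheory.Balaban1983to89.B10StarCount
import Mathlib.Algebra.Order.Chebyshev
import HarnessLib

/-!
# Route `UnitScaleTilt`, crux K1 «MinimiserStabilityRegPr» (stmt-QuantumFields-19200), route-R E′ path (α′), S3 K-form engine, row (H) junction (J-δ) — FILE 9v «(J-δ) COARSE COUNT»:
# the δ-side of ✓p681065 `junctionGroup_offsetFamily_le` with routeR-w1's straight coarse transport `S_(y,z) := T(B(z); Γ_(B(z),y))` (the comb of an ABSTRACT bi-contractive coarse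
# gauge field `T : PBond (K−n) → units`) is COUNTED: `Σ_y Σ_(z∈N(y)) ‖R(S_(y,z)) f(y) − f(B(z))‖² ≤ 4^d·(2d)²·ℓ^d·Σ_(c : PBond (K−n)) ‖(D_T f)(c)‖²` — site fibres `ℓ^d` (✓ `card_iterBlock`),
# coarse paths of `≤ 2d` steps (the support: `y − B(z) ∈ {−1,0,1,2}^d`), telescoping ✓p680187 `norm_R_holT_sub_le` + Cauchy–Schwarz, and the per-bond pair multiplicity by translation
# invariance of the torus; `D_T f (c) = R(T c) f(c₊) − f(c₋)` is ✓ `B9Eq39Adjoint.covD`'s letter at the coarse level — the `δ^T` of the junction, to be bridged to `δ^V` by ✓ `norm_R_sub_le_of_defect` ((Kg″))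

Cell `ym3-torus`, width seat `ym3-torus-px9` (gen 4); ★ym-ust-19200-p1 g16 NAMER WORD 17 «px9 g4: (J-δ) COARSE COUNT GO» (2026-08-29 00:56Z); routeR-w1 g6 00:54:34Z (letters: `T` abstract
family with `hT`, output `… ≤ C(d)·ℓ^d·Σ_c ‖R(T c)ψ(c_src) − ψ(c_tgt)‖²`-shape, `S` as a `holT` word so that the chain telescope applies).  THEOREMS ONLY (0 `def`, 0 `sorry`); `--supports
stmt-QuantumFields-19200 --as helper`, count-neutral.  YM₃ on T³ is a RUNG of the ladder (R3) — not d = 4, not infinite volume, not a mass gap, not the Clay problem; nothing here claims a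
stub, the crux or any summit statement.

WHAT IS PROVED (ns `…Theorems.Prop7JunctionDeltaCount`).
* §1 (any torus `Site P j`, bi-contractive `T`): `norm_covDstar_eq_norm_covD_unshift` (a backward letter is the forward letter of the reversed bond, isometry ✓ `norm_R_eq`),
  ★ `norm_R_holT_sub_sq_le_covD` (`‖R(T(x;w)) f(x + disp w) − f x‖² ≤ |w|·Σ_(k<|w|) ‖D_T f‖²(k-th bond, UNORIENTED: source `x + disp(w↾k)` or its `unshift`)`, ✓p680187 + Cauchy–Schwarz).
* §2 (counting on the torus): `card_filter_iterBlockOf_sub_eq` (`#{z : B(z − s𝟙) = B} = (L^d)^k`, ✓ `card_iterBlock` + the shift bijection), ★ `sum_comp_iterBlockOf_sub_le`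
  (`Σ_z g(B(z−s𝟙)) ≤ (L^d)^k·Σ_B g B`, `g ≥ 0`), `sum_transl_eq` (`Σ_B g(transl B q) = Σ_B g B`), `sum_dir_le_sum_pbond` (`Σ_B g⟨B,μ⟩ ≤ Σ_(c : PBond) g c`, `g ≥ 0`, ✓ `sum_pbond`),
  `sum_filter_image_le` (re-indexing a supported sum through an injective letter into the window `{−1,0,1,2}^d`).
* §3 ★★★ `sum_junction_delta_le` (T³ letters; support predicate and block letter `B(z) = iterBlockOf (K−n) (z − s𝟙)` VERBATIM ✓p681065; `v y z` the consumer's window letter with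
  `hv : N y z → v y z ∈ {−1,0,1,2}^d ∧ transl (B z) (v y z) = y`; `S y z := holT T (B z) (treeWord (v y z))`):
  `Σ_y Σ_z [N y z] ‖R(S y z) f(y) − f(B z)‖² ≤ (4^d·(2d)²·(L^d)^(K−n) : ℕ)·Σ_(c : PBond (F.P K) (K−n)) ‖covD (torusT) T c.dir f c.src‖²`.
* §4 (v1.1) `rel_mem_window_of_near` + ★★★ `sum_junction_delta_le_rel` — the same count with the CANONICAL window letter `v y z := rel (B z) y` (binders `v`, `hv` discharged by
  ✓ `exists_delta_of_near`, ✓ `rel_transl_of_mem`, ✓ `transl_rel` under the coarse period row `4 ≤ sitesPerDir (K−n)`).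
HONEST SCOPE.  Finite bookkeeping + kinematics; `f` is any coarse-site field (the consumer's `B ↦ φ₀(c_B)`); no estimate of `δ^T`, no `δ^T ↔ δ^V` bridge (✓ `norm_R_sub_le_of_defect`, the
displayed (Kg″)), no booking against `K_gauge`; the small-torus members (where the window letter `v` cannot exist) are the separate branch of ★p1 g16 WORD 15.

References: T. Bałaban, CMP 99 (1985) 389–434 [Balaban1985BackgroundPropagators] ((3.1) p.390, (3.3) p.390, (3.8) p.392); CMP 95 (1984) 17–40 [Balaban1984PropagatorsI] ((1.7) p.18,
(1.18) p.20); CMP 102 (1985) 255–275 [Balaban1985UV3] ((27) p.263).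
-/

set_option autoImplicit false

noncomputable section

open scoped BigOperators

namespace Summit.QuantumFields.YangMills.Theorems.Prop7JunctionDeltaCount

open Literature.MathematicalPhysics.QuantumFieldTheory.Balaban1983to89
open Literature.MathematicalPhysics.QuantumFieldTheory.Balaban1983to89.T3ContinuumYM3Torus
open B7Prop1Explicit (Letter e disp treeWord l1 disp_treeWord length_treeWord)
open B9Eq39Adjoint (R R_sub R_inv_R covD covDstar)
open B9TorusCalculus (torusT torusT_apply torusT_symm_apply)
open B10Eq27TorusAxialLog (holT transl transl_apply transl_add transl_zero transl_sub_e)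
open B5Eq118OneStroke (iterBlockOf iterBlock mem_iterBlock card_iterBlock)
open B10StarCount (sum_pbond shift_unshift)
open Summit.QuantumFields.YangMills.Theorems.Prop7PinnedSupOfGradient (norm_R_eq)
open Summit.QuantumFields.YangMills.Theorems.Prop7TransportTelescoping (norm_R_holT_sub_le)

/-! ## §1 Telescoping along a comb in UNORIENTED bond letters -/

section Torus

variable {𝔸 : Type*} [NormedRing 𝔸] {P : Params} {j : ℕ} (T : GaugeField P j 𝔸ˣ)
  (hT : ∀ b : PBond P j, ‖(T b : 𝔸)‖ ≤ 1 ∧ ‖(((T b)⁻¹ : 𝔸ˣ) : 𝔸)‖ ≤ 1)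

include hT in
/-- a BACKWARD letter is the FORWARD letter of the reversed bond: `‖(D*_T f)_μ(x)‖ = ‖(D_T f)_μ(x − e_μ)‖` (isometry of the adjoint transport).
[cite: Balaban1985BackgroundPropagators, (3.8) p.392, (3.1) p.390] -/
theorem norm_covDstar_eq_norm_covD_unshift (μ : Fin P.d) (f : Site P j → 𝔸) (x : Site P j) :
    ‖covDstar (torusT P j) (fun κ z => T ⟨z, κ⟩) μ f x‖ = ‖covD (torusT P j) (fun κ z => T ⟨z, κ⟩) μ f (x.unshift μ)‖ := by
  have hb := hT ⟨x.unshift μ, μ⟩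
  have hbi : ‖(((T ⟨x.unshift μ, μ⟩)⁻¹ : 𝔸ˣ) : 𝔸)‖ ≤ 1 ∧ ‖((((T ⟨x.unshift μ, μ⟩)⁻¹)⁻¹ : 𝔸ˣ) : 𝔸)‖ ≤ 1 := ⟨hb.2, by rw [inv_inv]; exact hb.1⟩
  rw [covDstar, covD, torusT_symm_apply, torusT_apply, shift_unshift]
  have e1 : R (T ⟨x.unshift μ, μ⟩)⁻¹ (f (x.unshift μ)) - f x = R (T ⟨x.unshift μ, μ⟩)⁻¹ (f (x.unshift μ) - R (T ⟨x.unshift μ, μ⟩) (f x)) := by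
    rw [R_sub, R_inv_R]
  rw [e1, norm_R_eq hbi.1 hbi.2, norm_sub_rev]

include hT in
/-- ★ **TELESCOPING ALONG A WORD, SQUARED, UNORIENTED BOND LETTERS**: `‖R(T(x;w)) f(x + disp w) − f(x)‖² ≤ |w|·Σ_(k<|w|) ‖(D_T f)(c_k)‖²`, the `k`-th bond `c_k` being
`⟨x + disp(w↾k), μ_k⟩` for a forward letter and `⟨(x + disp(w↾k)) − e_(μ_k), μ_k⟩` for a backward one (✓ `norm_R_holT_sub_le` + Cauchy–Schwarz + §1).
[cite: Balaban1985BackgroundPropagators, (3.1) p.390, (3.3) p.390, (3.8) p.392] -/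
theorem norm_R_holT_sub_sq_le_covD (f : Site P j → 𝔸) (x : Site P j) (w : List (Letter P.d)) :
    ‖R (holT T x w) (f (transl x (disp w))) - f x‖ ^ 2
      ≤ (w.length : ℝ) * ∑ k : Fin w.length,
          ‖covD (torusT P j) (fun κ z => T ⟨z, κ⟩) (w.get k).1 f
              (if (w.get k).2 then transl x (disp (w.take k)) else (transl x (disp (w.take k))).unshift (w.get k).1)‖ ^ 2 := by
  have h := norm_R_holT_sub_le T hT f x w
  have hterm : ∀ k : Fin w.length,
      (if (w.get k).2 then ‖covD (torusT P j) (fun κ z => T ⟨z, κ⟩) (w.get k).1 f (transl x (disp (w.take k)))‖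
        else ‖covDstar (torusT P j) (fun κ z => T ⟨z, κ⟩) (w.get k).1 f (transl x (disp (w.take k)))‖)
        = ‖covD (torusT P j) (fun κ z => T ⟨z, κ⟩) (w.get k).1 f
            (if (w.get k).2 then transl x (disp (w.take k)) else (transl x (disp (w.take k))).unshift (w.get k).1)‖ := by
    intro k
    split_ifs with hk
    · rfl
    · exact norm_covDstar_eq_norm_covD_unshift T hT _ f _
  simp only [hterm] at h
  refine (pow_le_pow_left₀ (norm_nonneg _) h 2).trans ?_
  have cs := sq_sum_le_card_mul_sum_sq (s := (Finset.univ : Finset (Fin w.length)))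
    (f := fun k => ‖covD (torusT P j) (fun κ z => T ⟨z, κ⟩) (w.get k).1 f
      (if (w.get k).2 then transl x (disp (w.take k)) else (transl x (disp (w.take k))).unshift (w.get k).1)‖)
  rw [Finset.card_univ, Fintype.card_fin] at cs
  exact cs

end Torus

/-! ## §2 Counting on the torus: block fibres, translations, bond sums, re-indexing -/

section Count

variable {P : Params}

/-- THE SITE FIBRE of the (shifted) block map: `#{z : Site 0 | iterBlockOf k (z − s𝟙) = B} = (L^d)^k` (✓ `card_iterBlock`, the shift `z ↦ z − s𝟙` being a bijection).
[cite: Balaban1984PropagatorsI, (1.18) p.20] -/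
theorem card_filter_iterBlockOf_sub_eq {k : ℕ} (hk : k ≤ P.m + P.K) (s : ZMod (P.sitesPerDir 0)) (B : Site P k) :
    (Finset.univ.filter (fun z : Site P 0 => iterBlockOf k (fun κ => z κ - s) = B)).card = (P.L ^ P.d) ^ k := by
  classical
  rw [← card_iterBlock k hk B]
  refine Finset.card_bij (fun z _ => fun κ => z κ - s) (fun z hz => ?_) (fun z₁ _ z₂ _ h => ?_) (fun z' hz' => ?_)
  · exact (mem_iterBlock k B _).mpr (Finset.mem_filter.mp hz).2
  · funext κ; have := congrFun h κ; simpa using this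
  · refine ⟨fun κ => z' κ + s, Finset.mem_filter.mpr ⟨Finset.mem_univ _, ?_⟩, ?_⟩
    · simp only [add_sub_cancel_right]; exact (mem_iterBlock k B z').mp hz'
    · funext κ; simp

/-- ★ summing a function of the (shifted) block over fine sites: `Σ_z g(B(z − s𝟙)) ≤ (L^d)^k · Σ_B g B` (in fact `=`, every fibre having exactly `(L^d)^k` sites; the bound is what the count consumes).
[cite: Balaban1984PropagatorsI, (1.18) p.20] -/
theorem sum_comp_iterBlockOf_sub_le {k : ℕ} (hk : k ≤ P.m + P.K) (s : ZMod (P.sitesPerDir 0)) (g : Site P k → ℝ) :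
    ∑ z : Site P 0, g (iterBlockOf k (fun κ => z κ - s)) ≤ (((P.L ^ P.d) ^ k : ℕ) : ℝ) * ∑ B : Site P k, g B := by
  classical
  rw [← Finset.sum_fiberwise_of_maps_to (s := (Finset.univ : Finset (Site P 0))) (t := (Finset.univ : Finset (Site P k)))
    (g := fun z : Site P 0 => iterBlockOf k (fun κ => z κ - s)) (fun z _ => Finset.mem_univ _), Finset.mul_sum]
  refine Finset.sum_le_sum fun B _ => ?_
  have hconst : ∑ z ∈ Finset.univ.filter (fun z : Site P 0 => iterBlockOf k (fun κ => z κ - s) = B), g (iterBlockOf k (fun κ => z κ - s))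
      = ∑ z ∈ Finset.univ.filter (fun z : Site P 0 => iterBlockOf k (fun κ => z κ - s) = B), g B :=
    Finset.sum_congr rfl fun z hz => by rw [(Finset.mem_filter.mp hz).2]
  rw [hconst, Finset.sum_const, card_filter_iterBlockOf_sub_eq hk s B, nsmul_eq_mul]

/-- translation invariance of a site sum: `Σ_B g(transl B q) = Σ_B g B`. [folklore] -/
theorem sum_transl_eq {k : ℕ} (q : B7Prop1Explicit.Site P.d) (g : Site P k → ℝ) :
    ∑ B : Site P k, g (transl B q) = ∑ B : Site P k, g B := by
  have h1 : ∀ B : Site P k, transl (transl B q) (-q) = B := fun B => by rw [← transl_add, add_neg_cancel, transl_zero]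
  have h2 : ∀ B : Site P k, transl (transl B (-q)) q = B := fun B => by rw [← transl_add, neg_add_cancel, transl_zero]
  exact Fintype.sum_equiv ⟨fun B => transl B q, fun B => transl B (-q), h1, h2⟩ _ _ (fun B => rfl)

/-- one direction's bonds inside all bonds: `Σ_B g⟨B, μ⟩ ≤ Σ_(c : PBond) g c` for `g ≥ 0` (✓ `sum_pbond`). [folklore] -/
theorem sum_dir_le_sum_pbond {k : ℕ} (μ : Fin P.d) (g : PBond P k → ℝ) (hg : ∀ c, 0 ≤ g c) :
    ∑ B : Site P k, g ⟨B, μ⟩ ≤ ∑ c : PBond P k, g c := by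
  rw [sum_pbond]
  exact Finset.sum_le_sum fun B _ => Finset.single_le_sum (f := fun ν => g ⟨B, ν⟩) (fun ν _ => hg _) (Finset.mem_univ μ)

/-- RE-INDEXING A SUPPORTED SUM THROUGH AN INJECTIVE LETTER: if on the support `N` the letter `v` takes values in the window `Wd` and determines the summation variable, then
`Σ_y [N y] G (v y) ≤ Σ_(u ∈ Wd) G u` for `G ≥ 0`. [folklore] -/
theorem sum_ite_le_sum_window {α β : Type*} [Fintype α] [DecidableEq β] (N : α → Prop) [DecidablePred N] (v : α → β) (Wd : Finset β) (G : β → ℝ) (hG : ∀ u, 0 ≤ G u)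
    (hv : ∀ y, N y → v y ∈ Wd) (hinj : ∀ y y', N y → N y' → v y = v y' → y = y') :
    ∑ y : α, (if N y then G (v y) else 0) ≤ ∑ u ∈ Wd, G u := by
  classical
  rw [← Finset.sum_filter]
  have hinj' : Set.InjOn v ↑(Finset.univ.filter N) := fun y hy y' hy' h =>
    hinj y y' (Finset.mem_filter.mp (Finset.mem_coe.mp hy)).2 (Finset.mem_filter.mp (Finset.mem_coe.mp hy')).2 h
  rw [← Finset.sum_image (f := G) hinj']
  refine Finset.sum_le_sum_of_subset_of_nonneg (fun u hu => ?_) fun u _ _ => hG u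
  obtain ⟨y, hy, rfl⟩ := Finset.mem_image.mp hu
  exact hv y (Finset.mem_filter.mp hy).2

/-- the window `{−1,0,1,2}^d`: `ℓ¹` size `≤ 2d` and cardinality `4^d`. [folklore] -/
theorem l1_le_of_mem_window {d : ℕ} (u : B7Prop1Explicit.Site d) (hu : u ∈ Fintype.piFinset (fun _ : Fin d => ({-1, 0, 1, 2} : Finset ℤ))) :
    l1 u ≤ 2 * d := by
  have hb : ∀ κ, (u κ).natAbs ≤ 2 := fun κ => by
    have h := Fintype.mem_piFinset.mp hu κ
    simp only [Finset.mem_insert, Finset.mem_singleton] at h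
    rcases h with h | h | h | h <;> rw [h] <;> decide
  calc l1 u = ∑ κ, (u κ).natAbs := rfl
    _ ≤ ∑ _κ : Fin d, 2 := Finset.sum_le_sum fun κ _ => hb κ
    _ = 2 * d := by rw [Finset.sum_const, Finset.card_univ, Fintype.card_fin, smul_eq_mul, mul_comm]

/-- … and `#{−1,0,1,2}^d = 4^d`. [folklore] -/
theorem card_window (d : ℕ) : (Fintype.piFinset (fun _ : Fin d => ({-1, 0, 1, 2} : Finset ℤ))).card = 4 ^ d := by
  rw [Fintype.card_piFinset, Finset.prod_const, Finset.card_univ, Fintype.card_fin]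
  rfl

end Count

/-! ## §3 The (J-δ) coarse count on T³ -/

section T3

variable {𝔸 : Type*} [NormedRing 𝔸]

/-- ★★★ **THE (J-δ) COARSE COUNT**: for the support `N(y)` of ✓p681065 (blocks `y` with `y − B(z) ∈ {−1,0,1,2}^d` coordinatewise, `B(z) = iterBlockOf (K−n) (z − s𝟙)`), an abstract
bi-contractive coarse gauge field `T` (the straight coarse transports), any coarse-site field `f` (the consumer's `B ↦ φ₀(c_B)`), and the window letter `v` of the pair
(`v y z ∈ {−1,0,1,2}^d`, `transl (B z) (v y z) = y` on the support), with `S_(y,z) := holT T (B z) (treeWord (v y z))` (the comb of `T` from `B(z)` to `y`):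
`Σ_y Σ_z [N y z] ‖R(S_(y,z)) f(y) − f(B(z))‖² ≤ 4^d·(2d)²·(L^d)^(K−n) · Σ_(c : PBond (K−n)) ‖(D_T f)(c)‖²` — site fibres, `≤ 2d`-step paths, per-bond pair multiplicity by translation invariance.
[cite: Balaban1985BackgroundPropagators, (3.1) p.390, (3.3) p.390, (3.8) p.392] [cite: Balaban1984PropagatorsI, (1.7) p.18, (1.18) p.20] [cite: Balaban1985UV3, (27) p.263] -/
theorem sum_junction_delta_le (F : T3Family) (K n : ℕ) (hk : K - n ≤ (F.P K).m + (F.P K).K)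
    (T : GaugeField (F.P K) (K - n) 𝔸ˣ) (hT : ∀ b : PBond (F.P K) (K - n), ‖(T b : 𝔸)‖ ≤ 1 ∧ ‖(((T b)⁻¹ : 𝔸ˣ) : 𝔸)‖ ≤ 1)
    (f : Site (F.P K) (K - n) → 𝔸) (v : Site (F.P K) (K - n) → Site (F.P K) 0 → B7Prop1Explicit.Site (F.P K).d)
    (hv : ∀ (y : Site (F.P K) (K - n)) (z : Site (F.P K) 0),
      (∀ ν : Fin (F.P K).d,
        (y ν = (iterBlockOf (K - n) (fun κ => z κ - (((((F.P K).L ^ (K - n) - 1) / 2 : ℕ)) : ZMod ((F.P K).sitesPerDir 0)))) ν - 1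
        ∨ y ν = (iterBlockOf (K - n) (fun κ => z κ - (((((F.P K).L ^ (K - n) - 1) / 2 : ℕ)) : ZMod ((F.P K).sitesPerDir 0)))) ν
        ∨ y ν = (iterBlockOf (K - n) (fun κ => z κ - (((((F.P K).L ^ (K - n) - 1) / 2 : ℕ)) : ZMod ((F.P K).sitesPerDir 0)))) ν + 1
        ∨ y ν = (iterBlockOf (K - n) (fun κ => z κ - (((((F.P K).L ^ (K - n) - 1) / 2 : ℕ)) : ZMod ((F.P K).sitesPerDir 0)))) ν + 2)) →
      v y z ∈ Fintype.piFinset (fun _ : Fin (F.P K).d => ({-1, 0, 1, 2} : Finset ℤ))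
        ∧ transl (iterBlockOf (K - n) (fun κ => z κ - (((((F.P K).L ^ (K - n) - 1) / 2 : ℕ)) : ZMod ((F.P K).sitesPerDir 0)))) (v y z) = y) :
    ∑ y : Site (F.P K) (K - n), ∑ z : Site (F.P K) 0,
      (if (∀ ν : Fin (F.P K).d,
          (y ν = (iterBlockOf (K - n) (fun κ => z κ - (((((F.P K).L ^ (K - n) - 1) / 2 : ℕ)) : ZMod ((F.P K).sitesPerDir 0)))) ν - 1
          ∨ y ν = (iterBlockOf (K - n) (fun κ => z κ - (((((F.P K).L ^ (K - n) - 1) / 2 : ℕ)) : ZMod ((F.P K).sitesPerDir 0)))) ν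
          ∨ y ν = (iterBlockOf (K - n) (fun κ => z κ - (((((F.P K).L ^ (K - n) - 1) / 2 : ℕ)) : ZMod ((F.P K).sitesPerDir 0)))) ν + 1
          ∨ y ν = (iterBlockOf (K - n) (fun κ => z κ - (((((F.P K).L ^ (K - n) - 1) / 2 : ℕ)) : ZMod ((F.P K).sitesPerDir 0)))) ν + 2))
        then ‖R (holT T (iterBlockOf (K - n) (fun κ => z κ - (((((F.P K).L ^ (K - n) - 1) / 2 : ℕ)) : ZMod ((F.P K).sitesPerDir 0)))) (treeWord (v y z))) (f y)
              - f (iterBlockOf (K - n) (fun κ => z κ - (((((F.P K).L ^ (K - n) - 1) / 2 : ℕ)) : ZMod ((F.P K).sitesPerDir 0))))‖ ^ 2 else 0)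
      ≤ ((4 ^ (F.P K).d * (2 * (F.P K).d) ^ 2 * ((F.P K).L ^ (F.P K).d) ^ (K - n) : ℕ) : ℝ)
        * ∑ c : PBond (F.P K) (K - n), ‖covD (torusT (F.P K) (K - n)) (fun κ z => T ⟨z, κ⟩) c.dir f c.src‖ ^ 2 := by
  classical
  -- abbreviations (local, proof-only)
  set s : ZMod ((F.P K).sitesPerDir 0) := (((((F.P K).L ^ (K - n) - 1) / 2 : ℕ)) : ZMod ((F.P K).sitesPerDir 0)) with hs
  set Bk : Site (F.P K) 0 → Site (F.P K) (K - n) := fun z => iterBlockOf (K - n) (fun κ => z κ - s) with hBk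
  set Wd : Finset (B7Prop1Explicit.Site (F.P K).d) := Fintype.piFinset (fun _ : Fin (F.P K).d => ({-1, 0, 1, 2} : Finset ℤ)) with hWd
  set δ : PBond (F.P K) (K - n) → ℝ := fun c => ‖covD (torusT (F.P K) (K - n)) (fun κ z => T ⟨z, κ⟩) c.dir f c.src‖ ^ 2 with hδ
  have hδ0 : ∀ c, 0 ≤ δ c := fun c => sq_nonneg _
  -- the per-pair quantity as a function of (block, window letter)
  set G : Site (F.P K) (K - n) → B7Prop1Explicit.Site (F.P K).d → ℝ :=
    fun B u => ‖R (holT T B (treeWord u)) (f (transl B u)) - f B‖ ^ 2 with hG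
  have hG0 : ∀ B u, 0 ≤ G B u := fun B u => sq_nonneg _
  -- the k-th bond of the comb of `u` from `B`: source `transl B (q_k u)` with a constant vector `q_k u`
  set src : B7Prop1Explicit.Site (F.P K).d → (k : ℕ) → B7Prop1Explicit.Site (F.P K).d :=
    fun u k => if ((treeWord u).getD k (0, true)).2 then disp ((treeWord u).take k) else disp ((treeWord u).take k) - e ((treeWord u).getD k (0, true)).1 with hsrc
  -- STEP 1: per pair, telescoping + CS in unoriented letters, ≤ 2d steps
  have step1 : ∀ (B : Site (F.P K) (K - n)) (u : B7Prop1Explicit.Site (F.P K).d), u ∈ Wd →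
      G B u ≤ (2 * (F.P K).d : ℝ) * ∑ k ∈ Finset.range (treeWord u).length, δ ⟨transl B (src u k), ((treeWord u).getD k (0, true)).1⟩ := by
    intro B u hu
    have h := norm_R_holT_sub_sq_le_covD T hT f B (treeWord u)
    rw [disp_treeWord] at h
    refine h.trans ?_
    have hlen : ((treeWord u).length : ℝ) ≤ 2 * (F.P K).d := by
      rw [length_treeWord]; exact_mod_cast l1_le_of_mem_window u hu
    rw [Finset.sum_range (f := fun k => δ ⟨transl B (src u k), ((treeWord u).getD k (0, true)).1⟩)]
    refine (mul_le_mul_of_nonneg_right hlen (Finset.sum_nonneg fun k _ => sq_nonneg _)).trans (mul_le_mul_of_nonneg_left (le_of_eq ?_) (by positivity))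
    refine Finset.sum_congr rfl fun k _ => ?_
    have hget : (treeWord u).getD (k : ℕ) (0, true) = (treeWord u).get k := by
      rw [List.getD_eq_getElem _ _ k.isLt]; rfl
    simp only [hδ, hsrc, hget]
    split_ifs with h2
    · rfl
    · rw [transl_sub_e]
  -- STEP 2: per (u, k), the sum over fine sites of the bond letter is ≤ fibre × all bonds
  have step2 : ∀ (u : B7Prop1Explicit.Site (F.P K).d) (k : ℕ),
      ∑ z : Site (F.P K) 0, δ ⟨transl (Bk z) (src u k), ((treeWord u).getD k (0, true)).1⟩
        ≤ ((((F.P K).L ^ (F.P K).d) ^ (K - n) : ℕ) : ℝ) * ∑ c : PBond (F.P K) (K - n), δ c := by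
    intro u k
    have h1 := sum_comp_iterBlockOf_sub_le hk s (fun B => δ ⟨transl B (src u k), ((treeWord u).getD k (0, true)).1⟩)
    refine h1.trans (mul_le_mul_of_nonneg_left ?_ (by positivity))
    rw [sum_transl_eq (src u k) (fun B => δ ⟨B, ((treeWord u).getD k (0, true)).1⟩)]
    exact sum_dir_le_sum_pbond _ δ hδ0
  -- STEP 3: re-index the supported y-sum through the window letter, per z
  have step3 : ∀ z : Site (F.P K) 0,
      ∑ y : Site (F.P K) (K - n),
        (if (∀ ν : Fin (F.P K).d, (y ν = Bk z ν - 1 ∨ y ν = Bk z ν ∨ y ν = Bk z ν + 1 ∨ y ν = Bk z ν + 2))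
          then ‖R (holT T (Bk z) (treeWord (v y z))) (f y) - f (Bk z)‖ ^ 2 else 0)
        ≤ ∑ u ∈ Wd, G (Bk z) u := by
    intro z
    have hrw : ∀ y : Site (F.P K) (K - n),
        (if (∀ ν : Fin (F.P K).d, (y ν = Bk z ν - 1 ∨ y ν = Bk z ν ∨ y ν = Bk z ν + 1 ∨ y ν = Bk z ν + 2))
          then ‖R (holT T (Bk z) (treeWord (v y z))) (f y) - f (Bk z)‖ ^ 2 else 0)
        = (if (∀ ν : Fin (F.P K).d, (y ν = Bk z ν - 1 ∨ y ν = Bk z ν ∨ y ν = Bk z ν + 1 ∨ y ν = Bk z ν + 2)) then G (Bk z) (v y z) else 0) := by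
      intro y
      split_ifs with hy
      · simp only [hG]; rw [(hv y z hy).2]
      · rfl
    rw [Finset.sum_congr rfl fun y _ => hrw y]
    refine sum_ite_le_sum_window _ (fun y => v y z) Wd (G (Bk z)) (hG0 _) (fun y hy => (hv y z hy).1) (fun y y' hy hy' h => ?_)
    rw [← (hv y z hy).2, ← (hv y' z hy').2, h]
  -- ASSEMBLY
  calc ∑ y : Site (F.P K) (K - n), ∑ z : Site (F.P K) 0,
        (if (∀ ν : Fin (F.P K).d, (y ν = Bk z ν - 1 ∨ y ν = Bk z ν ∨ y ν = Bk z ν + 1 ∨ y ν = Bk z ν + 2))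
          then ‖R (holT T (Bk z) (treeWord (v y z))) (f y) - f (Bk z)‖ ^ 2 else 0)
      = ∑ z : Site (F.P K) 0, ∑ y : Site (F.P K) (K - n),
        (if (∀ ν : Fin (F.P K).d, (y ν = Bk z ν - 1 ∨ y ν = Bk z ν ∨ y ν = Bk z ν + 1 ∨ y ν = Bk z ν + 2))
          then ‖R (holT T (Bk z) (treeWord (v y z))) (f y) - f (Bk z)‖ ^ 2 else 0) := Finset.sum_comm
    _ ≤ ∑ z : Site (F.P K) 0, ∑ u ∈ Wd, G (Bk z) u := Finset.sum_le_sum fun z _ => step3 z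
    _ ≤ ∑ z : Site (F.P K) 0, ∑ u ∈ Wd, (2 * (F.P K).d : ℝ) * ∑ k ∈ Finset.range (treeWord u).length, δ ⟨transl (Bk z) (src u k), ((treeWord u).getD k (0, true)).1⟩ :=
        Finset.sum_le_sum fun z _ => Finset.sum_le_sum fun u hu => step1 (Bk z) u hu
    _ = (2 * (F.P K).d : ℝ) * ∑ u ∈ Wd, ∑ k ∈ Finset.range (treeWord u).length, ∑ z : Site (F.P K) 0, δ ⟨transl (Bk z) (src u k), ((treeWord u).getD k (0, true)).1⟩ := by
        rw [Finset.sum_comm, Finset.mul_sum]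
        refine Finset.sum_congr rfl fun u _ => ?_
        rw [← Finset.mul_sum, Finset.sum_comm]
    _ ≤ (2 * (F.P K).d : ℝ) * ∑ u ∈ Wd, ∑ _k ∈ Finset.range (treeWord u).length, (((((F.P K).L ^ (F.P K).d) ^ (K - n) : ℕ) : ℝ) * ∑ c : PBond (F.P K) (K - n), δ c) :=
        mul_le_mul_of_nonneg_left (Finset.sum_le_sum fun u _ => Finset.sum_le_sum fun k _ => step2 u k) (by positivity)
    _ ≤ (2 * (F.P K).d : ℝ) * ∑ _u ∈ Wd, ((2 * (F.P K).d : ℝ) * (((((F.P K).L ^ (F.P K).d) ^ (K - n) : ℕ) : ℝ) * ∑ c : PBond (F.P K) (K - n), δ c)) := by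
        refine mul_le_mul_of_nonneg_left (Finset.sum_le_sum fun u hu => ?_) (by positivity)
        rw [Finset.sum_const, Finset.card_range, nsmul_eq_mul]
        refine mul_le_mul_of_nonneg_right ?_ (by positivity)
        rw [length_treeWord]; exact_mod_cast l1_le_of_mem_window u hu
    _ = ((4 ^ (F.P K).d * (2 * (F.P K).d) ^ 2 * ((F.P K).L ^ (F.P K).d) ^ (K - n) : ℕ) : ℝ) * ∑ c : PBond (F.P K) (K - n), δ c := by
        rw [Finset.sum_const, hWd, card_window, nsmul_eq_mul]; push_cast; ring

end T3


/-! ## §4 (v1.1, append-only) The window letter discharged: `v y z := rel (B z) y` -/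

section Rel

open B10Eq27TorusAxialLog (rel transl_rel rel_transl_of_mem)
open Summit.QuantumFields.YangMills.Theorems.Prop7OffsetFamilyWindow (exists_delta_of_near)

/-- on the support (`y_ν ∈ {B_ν − 1, B_ν, B_ν + 1, B_ν + 2}`), the relative position `rel B y` lies in the window `{−1,0,1,2}^d` as soon as the coarse period is `≥ 4` (so that `−1` and `2` are
least-absolute-value representatives; ✓ `exists_delta_of_near`, ✓ `rel_transl_of_mem`). [cite: Balaban1985UV3, (27) p.263] -/
theorem rel_mem_window_of_near {P : Params} {k : ℕ} (hN4 : 4 ≤ P.sitesPerDir k) (B y : Site P k)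
    (h : ∀ ν : Fin P.d, y ν = B ν - 1 ∨ y ν = B ν ∨ y ν = B ν + 1 ∨ y ν = B ν + 2) :
    rel B y ∈ Fintype.piFinset (fun _ : Fin P.d => ({-1, 0, 1, 2} : Finset ℤ)) := by
  classical
  have hδ : ∀ ν, ∃ δ : ℤ, -1 ≤ δ ∧ δ ≤ 2 ∧ y ν = B ν + ((δ : ℤ) : ZMod (P.sitesPerDir k)) := fun ν => exists_delta_of_near (y ν) (B ν) (h ν)
  choose δ hδ1 hδ2 hδ3 using hδ
  have hy : y = transl B δ := by
    funext ν; rw [transl_apply]; exact hδ3 ν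
  have hN : (4 : ℤ) ≤ (P.sitesPerDir k : ℤ) := by exact_mod_cast hN4
  have hrel : rel B y = δ := by
    rw [hy]
    refine rel_transl_of_mem B δ fun ν => ?_
    have h1 := hδ1 ν; have h2 := hδ2 ν
    exact ⟨by omega, by omega⟩
  rw [hrel, Fintype.mem_piFinset]
  intro ν
  have h1 := hδ1 ν; have h2 := hδ2 ν
  simp only [Finset.mem_insert, Finset.mem_singleton]
  omega

variable {𝔸 : Type*} [NormedRing 𝔸]

/-- ★★★ **THE (J-δ) COARSE COUNT WITH THE CANONICAL WINDOW LETTER** `v y z := rel (B z) y` (no `v`, `hv` binders): under the coarse period row `4 ≤ sitesPerDir (K−n)`,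
`Σ_y Σ_z [N y z] ‖R(holT T (B z) (treeWord (rel (B z) y))) f(y) − f(B z)‖² ≤ 4^d·(2d)²·(L^d)^(K−n)·Σ_(c : PBond (K−n)) ‖(D_T f)(c)‖²` (✓ `sum_junction_delta_le` ∘ ✓ `rel_mem_window_of_near` ∘ ✓ `transl_rel`).
[cite: Balaban1985BackgroundPropagators, (3.1) p.390, (3.3) p.390, (3.8) p.392] [cite: Balaban1984PropagatorsI, (1.7) p.18, (1.18) p.20] [cite: Balaban1985UV3, (27) p.263] -/
theorem sum_junction_delta_le_rel (F : T3Family) (K n : ℕ) (hk : K - n ≤ (F.P K).m + (F.P K).K) (hN4 : 4 ≤ (F.P K).sitesPerDir (K - n))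
    (T : GaugeField (F.P K) (K - n) 𝔸ˣ) (hT : ∀ b : PBond (F.P K) (K - n), ‖(T b : 𝔸)‖ ≤ 1 ∧ ‖(((T b)⁻¹ : 𝔸ˣ) : 𝔸)‖ ≤ 1)
    (f : Site (F.P K) (K - n) → 𝔸) :
    ∑ y : Site (F.P K) (K - n), ∑ z : Site (F.P K) 0,
      (if (∀ ν : Fin (F.P K).d,
          (y ν = (iterBlockOf (K - n) (fun κ => z κ - (((((F.P K).L ^ (K - n) - 1) / 2 : ℕ)) : ZMod ((F.P K).sitesPerDir 0)))) ν - 1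
          ∨ y ν = (iterBlockOf (K - n) (fun κ => z κ - (((((F.P K).L ^ (K - n) - 1) / 2 : ℕ)) : ZMod ((F.P K).sitesPerDir 0)))) ν
          ∨ y ν = (iterBlockOf (K - n) (fun κ => z κ - (((((F.P K).L ^ (K - n) - 1) / 2 : ℕ)) : ZMod ((F.P K).sitesPerDir 0)))) ν + 1
          ∨ y ν = (iterBlockOf (K - n) (fun κ => z κ - (((((F.P K).L ^ (K - n) - 1) / 2 : ℕ)) : ZMod ((F.P K).sitesPerDir 0)))) ν + 2))
        then ‖R (holT T (iterBlockOf (K - n) (fun κ => z κ - (((((F.P K).L ^ (K - n) - 1) / 2 : ℕ)) : ZMod ((F.P K).sitesPerDir 0))))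
                (treeWord (rel (iterBlockOf (K - n) (fun κ => z κ - (((((F.P K).L ^ (K - n) - 1) / 2 : ℕ)) : ZMod ((F.P K).sitesPerDir 0)))) y))) (f y)
              - f (iterBlockOf (K - n) (fun κ => z κ - (((((F.P K).L ^ (K - n) - 1) / 2 : ℕ)) : ZMod ((F.P K).sitesPerDir 0))))‖ ^ 2 else 0)
      ≤ ((4 ^ (F.P K).d * (2 * (F.P K).d) ^ 2 * ((F.P K).L ^ (F.P K).d) ^ (K - n) : ℕ) : ℝ)
        * ∑ c : PBond (F.P K) (K - n), ‖covD (torusT (F.P K) (K - n)) (fun κ z => T ⟨z, κ⟩) c.dir f c.src‖ ^ 2 :=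
  sum_junction_delta_le F K n hk T hT f
    (fun y z => rel (iterBlockOf (K - n) (fun κ => z κ - (((((F.P K).L ^ (K - n) - 1) / 2 : ℕ)) : ZMod ((F.P K).sitesPerDir 0)))) y)
    (fun y _ hyz => ⟨rel_mem_window_of_near hN4 _ y hyz, transl_rel _ _⟩)

end Rel

end Summit.QuantumFields.YangMills.Theorems.Prop7JunctionDeltaCount

end
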